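import Summits.RiemannHypothesis.RiemannHypothesis.Theorems.TiltedLandingLaw421R3NewtonDoor1

/-!
# W-08 NewtonDoor Part 2/4 — Near-zero variation through far-field bound

Split from `NewtonDoor-W08-C1-rh-idea-5-g28.lean` (v17 ad5354c4).
-/

namespace RhW08.NewtonDoor

/-! ## The NEAR-ZERO part of `Λ`: variation of a finite pole sum (elementary) -/

/-- VARIATION OF A FINITE POLE SUM: for poles `a ∈ S` with non-negative weights `m a` (multiplicities) and two points `z, v` off the poles,
`‖Σ m_a/(z − a) − Σ m_a/(v − a)‖ ≤ ‖z − v‖ · Σ m_a/(‖z − a‖·‖v − a‖)`.  With `P = ∏ (· − a)^{m_a}` the near factor of the cofactor `h`, this is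
the near-zero part of the Lipschitz constant `Λ` of `succ_of_newton_door_lip` (`P′/P = Σ m_a/(· − a)`, tree `deriv_prod_pow_sub_div`). -/
theorem nearSum_variation (S : Finset ℂ) (m : ℂ → ℝ) (hm : ∀ a ∈ S, 0 ≤ m a) {z v : ℂ} (hz : ∀ a ∈ S, z ≠ a) (hv : ∀ a ∈ S, v ≠ a) :
    ‖∑ a ∈ S, (m a : ℂ) / (z - a) - ∑ a ∈ S, (m a : ℂ) / (v - a)‖ ≤ ‖z - v‖ * ∑ a ∈ S, m a / (‖z - a‖ * ‖v - a‖) := by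
  rw [← Finset.sum_sub_distrib, Finset.mul_sum]
  refine (norm_sum_le _ _).trans (Finset.sum_le_sum fun a ha => ?_)
  have hza : z - a ≠ 0 := sub_ne_zero.mpr (hz a ha)
  have hva : v - a ≠ 0 := sub_ne_zero.mpr (hv a ha)
  have hid : (m a : ℂ) / (z - a) - (m a : ℂ) / (v - a) = (m a : ℂ) * (v - z) / ((z - a) * (v - a)) := by
    field_simp
    ring
  rw [hid, norm_div, norm_mul, norm_mul, Complex.norm_real, Real.norm_eq_abs, abs_of_nonneg (hm a ha), norm_sub_rev v z]
  exact le_of_eq (by ring)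

/-- ISOLATION form of the near-zero variation: if every pole is at distance `≥ d > r ≥ ‖z − v‖` from `v`, then
`‖Σ m_a/(z − a) − Σ m_a/(v − a)‖ ≤ ‖z − v‖ · (Σ m_a) / ((d − r)·d)`. -/
theorem nearSum_variation_of_isolated (S : Finset ℂ) (m : ℂ → ℝ) (hm : ∀ a ∈ S, 0 ≤ m a) {z v : ℂ} {d r : ℝ}
    (hr : ‖z - v‖ ≤ r) (hrd : r < d) (hiso : ∀ a ∈ S, d ≤ ‖v - a‖) :
    ‖∑ a ∈ S, (m a : ℂ) / (z - a) - ∑ a ∈ S, (m a : ℂ) / (v - a)‖ ≤ ‖z - v‖ * ((∑ a ∈ S, m a) / ((d - r) * d)) := by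
  have hd : 0 < d := lt_of_le_of_lt (le_trans (norm_nonneg _) hr) hrd
  have hdr : 0 < d - r := by linarith
  have hza' : ∀ a ∈ S, d - r ≤ ‖z - a‖ := by
    intro a ha
    have h1 : ‖v - a‖ ≤ ‖v - z‖ + ‖z - a‖ := by
      calc ‖v - a‖ = ‖(v - z) + (z - a)‖ := by congr 1; ring
        _ ≤ ‖v - z‖ + ‖z - a‖ := norm_add_le _ _
    rw [norm_sub_rev v z] at h1
    linarith [hiso a ha]
  have hz : ∀ a ∈ S, z ≠ a := by
    intro a ha h0; have := hza' a ha; rw [h0, sub_self, norm_zero] at this; linarith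
  have hv : ∀ a ∈ S, v ≠ a := by
    intro a ha h0; have := hiso a ha; rw [h0, sub_self, norm_zero] at this; linarith
  refine (nearSum_variation S m hm hz hv).trans (mul_le_mul_of_nonneg_left ?_ (norm_nonneg _))
  rw [Finset.sum_div]
  refine Finset.sum_le_sum fun a ha => ?_
  have h1 : (d - r) * d ≤ ‖z - a‖ * ‖v - a‖ := mul_le_mul (hza' a ha) (hiso a ha) hd.le (le_trans hdr.le (hza' a ha))
  exact div_le_div_of_nonneg_left (hm a ha) (mul_pos hdr hd) h1

/-- ASSEMBLY OF `Λ` (near + far): if on the Newton circle the cofactor field splits as `h′/h = N + g` with `N` the near pole sum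
(`N z = Σ m_a/(z − a)`, poles at distance `≥ d` from `v`) and `g` (the far-factor field) LIPSCHITZ about `v` with constant `L`, and
`K = N v + g v`, then `‖h′/h(z) − K‖ ≤ r·(Σ m_a)/((d − r)·d) + L·r` for `‖z − v‖ ≤ r < d`.  This is the `Λ` of `succ_of_newton_door_lip`
with `r = (1 + ρ₀)/‖K‖`; `L` comes from `Literature.Analysis.Complex.KimLee.norm_logDeriv_sub_logDeriv_zero_le`. -/
theorem lipschitz_of_near_far (S : Finset ℂ) (m : ℂ → ℝ) (hm : ∀ a ∈ S, 0 ≤ m a) {g : ℂ → ℂ} {K v z q : ℂ} {d r L : ℝ}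
    (hr : ‖z - v‖ ≤ r) (hrd : r < d) (hiso : ∀ a ∈ S, d ≤ ‖v - a‖) (hL : 0 ≤ L)
    (hg : ‖g z - g v‖ ≤ L * ‖z - v‖)
    (hq : q = ∑ a ∈ S, (m a : ℂ) / (z - a) + g z)
    (hK : K = ∑ a ∈ S, (m a : ℂ) / (v - a) + g v) :
    ‖q - K‖ ≤ r * ((∑ a ∈ S, m a) / ((d - r) * d)) + L * r := by
  have hd : 0 < d := lt_of_le_of_lt (le_trans (norm_nonneg _) hr) hrd
  have hdr : 0 < d - r := by linarith
  have hsum0 : 0 ≤ (∑ a ∈ S, m a) / ((d - r) * d) := div_nonneg (Finset.sum_nonneg hm) (mul_pos hdr hd).le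
  have hsplit : q - K = (∑ a ∈ S, (m a : ℂ) / (z - a) - ∑ a ∈ S, (m a : ℂ) / (v - a)) + (g z - g v) := by
    rw [hq, hK]; ring
  rw [hsplit]
  refine (norm_add_le _ _).trans ?_
  have h1 := nearSum_variation_of_isolated S m hm hr hrd hiso
  have h2 : ‖z - v‖ * ((∑ a ∈ S, m a) / ((d - r) * d)) ≤ r * ((∑ a ∈ S, m a) / ((d - r) * d)) :=
    mul_le_mul_of_nonneg_right hr hsum0
  have h3 : L * ‖z - v‖ ≤ L * r := mul_le_mul_of_nonneg_left hr hL
  linarith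

/-! ## The NEAR/FAR SPLIT of the cofactor field (generic identity; the hand supplies the factorisation `h = P·G` near the circle) -/

/-- Log-derivative of `(∏_{a ∈ S} (· − a)^{m a}) · G` off the poles: `Σ m_a/(z − a) + G′/G(z)`. -/
theorem logDeriv_nearFar (S : Finset ℂ) (m : ℂ → ℕ) {G : ℂ → ℂ} {z : ℂ} (hz : ∀ a ∈ S, z ≠ a)
    (hG : DifferentiableAt ℂ G z) (hGz : G z ≠ 0) :
    logDeriv (fun w : ℂ => (∏ a ∈ S, (w - a) ^ (m a)) * G w) z = ∑ a ∈ S, ((m a : ℕ) : ℂ) / (z - a) + logDeriv G z := by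
  have hne : ∀ a ∈ S, (fun w : ℂ => (w - a) ^ (m a)) z ≠ 0 := fun a ha => pow_ne_zero _ (sub_ne_zero.mpr (hz a ha))
  have hdiff : ∀ a ∈ S, DifferentiableAt ℂ (fun w : ℂ => (w - a) ^ (m a)) z := fun a _ => by fun_prop
  have hP0 : (∏ a ∈ S, (z - a) ^ (m a)) ≠ 0 := Finset.prod_ne_zero_iff.mpr fun a ha => hne a ha
  have hPd : DifferentiableAt ℂ (fun w : ℂ => ∏ a ∈ S, (w - a) ^ (m a)) z := by fun_prop
  rw [logDeriv_mul (f := fun w : ℂ => ∏ a ∈ S, (w - a) ^ (m a)) (g := G) z hP0 hGz hPd hG,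
    logDeriv_prod (f := fun a (w : ℂ) => (w - a) ^ (m a)) hne hdiff]
  congr 1
  refine Finset.sum_congr rfl fun a ha => ?_
  have hsub : DifferentiableAt ℂ (fun w : ℂ => w - a) z := by fun_prop
  rw [logDeriv_fun_pow (f := fun w : ℂ => w - a) hsub (m a), logDeriv_apply]
  have hd : deriv (fun w : ℂ => w - a) z = 1 := by
    rw [deriv_sub_const, deriv_id'']
  rw [hd]
  field_simp

/-- THE SPLIT AT A POINT: if `h` agrees near `z` with `(∏_{a ∈ S} (· − a)^{m a}) · G` (`G` differentiable and non-zero at `z`, `z` off the poles), then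
`h′(z)/h(z) = Σ m_a/(z − a) + G′(z)/G(z)` — the `N + g` decomposition consumed by `lipschitz_of_near_far`. -/
theorem field_split (S : Finset ℂ) (m : ℂ → ℕ) {h G : ℂ → ℂ} {z : ℂ} (hz : ∀ a ∈ S, z ≠ a)
    (hG : DifferentiableAt ℂ G z) (hGz : G z ≠ 0) (heq : ∀ᶠ w in nhds z, h w = (∏ a ∈ S, (w - a) ^ (m a)) * G w) :
    deriv h z / h z = ∑ a ∈ S, ((m a : ℕ) : ℂ) / (z - a) + deriv G z / G z := by
  have h1 : deriv h z = deriv (fun w : ℂ => (∏ a ∈ S, (w - a) ^ (m a)) * G w) z := Filter.EventuallyEq.deriv_eq heq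
  have h2 : h z = (∏ a ∈ S, (z - a) ^ (m a)) * G z := by
    have := heq.self_of_nhds
    exact this
  have h3 := logDeriv_nearFar S m hz hG hGz
  simp only [logDeriv_apply] at h3
  rw [h1, h2]
  exact h3

/-! ## The FAR part of `Λ`: a bounded holomorphic field is Lipschitz one collar in (Cauchy + mean value, centre-free) -/

/-- CAUCHY + MEAN VALUE, centre-free: if `g` is holomorphic on the closed ball `‖w − c‖ ≤ r + δ` and bounded there by `ε`, then on the ball
`‖w − c‖ ≤ r` it is LIPSCHITZ with constant `ε/δ`.  (Apply to `g = G′/G`, the far-factor field, with `ε` from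
`Literature.Analysis.Complex.KimLee.norm_logDeriv_farFactor_le_of_ne_zero`; this is the two-point, any-centre form of
`KimLee.norm_logDeriv_sub_logDeriv_zero_le`.) -/
theorem lipschitz_of_bounded_holo {g : ℂ → ℂ} {c : ℂ} {r δ ε : ℝ} (hδ : 0 < δ)
    (hg : DifferentiableOn ℂ g (Metric.closedBall c (r + δ))) (hb : ∀ w ∈ Metric.closedBall c (r + δ), ‖g w‖ ≤ ε) {z v : ℂ}
    (hz : z ∈ Metric.closedBall c r) (hv : v ∈ Metric.closedBall c r) : ‖g z - g v‖ ≤ ε / δ * ‖z - v‖ := by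
  -- derivative bound on the small ball
  have hder : ∀ w ∈ Metric.closedBall c r, ‖deriv g w‖ ≤ ε / δ := by
    intro w hw
    rw [Metric.mem_closedBall, dist_eq_norm] at hw
    have hsub : Metric.closedBall w δ ⊆ Metric.closedBall c (r + δ) := by
      intro u hu
      rw [Metric.mem_closedBall, dist_eq_norm] at hu ⊢
      calc ‖u - c‖ = ‖(u - w) + (w - c)‖ := by congr 1; ring
        _ ≤ ‖u - w‖ + ‖w - c‖ := norm_add_le _ _
        _ ≤ r + δ := by linarith
    refine Complex.norm_deriv_le_of_forall_mem_sphere_norm_le hδ ?_ fun u hu => ?_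
    · apply DifferentiableOn.diffContOnCl
      rw [closure_ball w hδ.ne']
      exact hg.mono hsub
    · exact hb u (hsub (Metric.sphere_subset_closedBall hu))
  -- differentiability at the points of the small ball (interior of the big one)
  have hdiff : ∀ w ∈ Metric.closedBall c r, DifferentiableAt ℂ g w := by
    intro w hw
    rw [Metric.mem_closedBall, dist_eq_norm] at hw
    apply hg.differentiableAt
    apply Metric.closedBall_mem_nhds_of_mem
    rw [Metric.mem_ball, dist_eq_norm]
    linarith
  have h := Convex.norm_image_sub_le_of_norm_deriv_le (f := g) (s := Metric.closedBall c r) (C := ε / δ)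
    (fun w hw => hdiff w hw) (fun w hw => hder w hw) (convex_closedBall c r) hv hz
  exact h

/-! ## The LOCAL FACTORISATION of the cofactor off the zero `v` (peel one linear factor off the disc factorisation; generic) -/

/-- PEEL-OFF: if `F = (· − v)·h` everywhere, `F = (∏_{u ∈ S} (· − u)^{D u})·G` on a neighbourhood `U` of `z`, the zero `v` is SIMPLE in the product
(`v ∈ S`, `D v = 1`) and `z ≠ v`, then near `z` the cofactor is `h = (∏_{u ∈ S \ {v}} (· − u)^{D u})·G` — the hypothesis `heq` of `field_split`
with `S.erase v` as the near set. (The hand takes `S`, `D`, `G` from `Literature.Analysis.Complex.exists_eq_prod_pow_sub_mul` applied to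
`F = f^{(j)}` on a disc about a non-zero point near `v`, and `h = dslope F v` via `factor_dslope`; a multiple `v` is `succ_of_multiple` instead.) -/
theorem dslope_local_factor {F h G : ℂ → ℂ} (S : Finset ℂ) (D : ℂ → ℕ) {v z : ℂ} {U : Set ℂ} (hU : U ∈ nhds z)
    (hfac : ∀ w ∈ U, F w = (∏ u ∈ S, (w - u) ^ (D u)) * G w) (hv : v ∈ S) (hDv : D v = 1) (hzv : z ≠ v)
    (hF : ∀ w, F w = (w - v) * h w) :
    ∀ᶠ w in nhds z, h w = (∏ u ∈ S.erase v, (w - u) ^ (D u)) * G w := by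
  classical
  have h1 : ∀ᶠ w in nhds z, w ∈ U := Filter.eventually_of_mem hU fun w hw => hw
  have h2 : ∀ᶠ w in nhds z, w ≠ v := eventually_ne_nhds hzv
  filter_upwards [h1, h2] with w hwU hwv
  have hwv' : (w - v) ≠ 0 := sub_ne_zero.mpr hwv
  have hsplit : (∏ u ∈ S, (w - u) ^ (D u)) = (w - v) * ∏ u ∈ S.erase v, (w - u) ^ (D u) := by
    rw [← Finset.mul_prod_erase S (fun u => (w - u) ^ (D u)) hv, hDv, pow_one]
  have key : (w - v) * h w = (w - v) * ((∏ u ∈ S.erase v, (w - u) ^ (D u)) * G w) := by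
    rw [← hF w, hfac w hwU, hsplit, mul_assoc]
  exact mul_left_cancel₀ hwv' key

/-! ## INSTANTIATION: the disc factorisation of `F` about a non-zero point, peeled at the simple zero `v` -/

/-- The divisor of an analytic function at a SIMPLE zero is `1`. -/
theorem divisor_eq_one_of_simple {F : ℂ → ℂ} {c v : ℂ} {R₂ : ℝ} (hF : AnalyticOnNhd ℂ F (Metric.closedBall c R₂))
    (hv : v ∈ Metric.closedBall c R₂) (hord : analyticOrderAt F v = 1) :
    MeromorphicOn.divisor F (Metric.closedBall c R₂) v = 1 := by
  rw [hF.meromorphicOn.divisor_apply hv, (hF v hv).meromorphicOrderAt_eq, hord]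
  rfl

/-- A simple zero lies in the (finite) support of the divisor. -/
theorem mem_toFinset_of_simple {F : ℂ → ℂ} {c v : ℂ} {R₂ : ℝ} (hF : AnalyticOnNhd ℂ F (Metric.closedBall c R₂))
    (hv : v ∈ Metric.closedBall c R₂) (hord : analyticOrderAt F v = 1) :
    v ∈ ((MeromorphicOn.divisor F (Metric.closedBall c R₂)).finiteSupport (isCompact_closedBall c R₂)).toFinset := by
  rw [Set.Finite.mem_toFinset, Function.mem_support, divisor_eq_one_of_simple hF hv hord]
  exact one_ne_zero

/-- The NEAR SET of `F` in the inner ball `‖z − c‖ ≤ R₂`: the (finite) support of its divisor there, as a `Finset`. -/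
noncomputable def nearSet (F : ℂ → ℂ) (c : ℂ) (R₂ : ℝ) : Finset ℂ :=
  ((MeromorphicOn.divisor F (Metric.closedBall c R₂)).finiteSupport (isCompact_closedBall c R₂)).toFinset

/-- The NEAR MULTIPLICITIES: the divisor of `F` in the inner ball, as natural numbers. -/
noncomputable def nearMult (F : ℂ → ℂ) (c : ℂ) (R₂ : ℝ) : ℂ → ℕ :=
  fun u => ((MeromorphicOn.divisor F (Metric.closedBall c R₂)) u).toNat

/-- COFACTOR LOCAL FACTORISATION (the bookkeeping step (1), done): `F` analytic on `‖z − c‖ ≤ R` with `F c ≠ 0`, `v` a SIMPLE zero in the inner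
ball `‖z − c‖ ≤ R₂` (`0 < R₂ ≤ R`), `F = (· − v)·h`. Then there are a far factor `G` (analytic on the big ball, zero-free on the inner ball), the near
set `S` (the zeros of `F` in the inner ball: `S ⊆` inner ball, `F = 0` on `S`, `v ∈ S`) and multiplicities `D` with `F = (∏_{u∈S}(· − u)^{D u})·G` on the big ball and,
near every point `z ≠ v` of the OPEN big ball, `h = (∏_{u ∈ S \ {v}}(· − u)^{D u})·G` — exactly the `heq` of `field_split` (near set `S.erase v`). -/
theorem cofactor_local_factor {F h : ℂ → ℂ} {c v : ℂ} {R₂ R : ℝ} (hR₂ : 0 < R₂) (hR : R₂ ≤ R)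
    (hF : AnalyticOnNhd ℂ F (Metric.closedBall c R)) (hc : F c ≠ 0) (hv : v ∈ Metric.closedBall c R₂) (hord : analyticOrderAt F v = 1)
    (hFh : ∀ w, F w = (w - v) * h w) :
    ∃ G : ℂ → ℂ, AnalyticOnNhd ℂ G (Metric.closedBall c R) ∧ (∀ z ∈ Metric.closedBall c R₂, G z ≠ 0) ∧
      (∀ u ∈ nearSet F c R₂, u ∈ Metric.closedBall c R₂) ∧ (∀ u ∈ nearSet F c R₂, F u = 0) ∧ v ∈ nearSet F c R₂ ∧ nearMult F c R₂ v = 1 ∧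
      (∀ z ∈ Metric.closedBall c R, F z = (∏ u ∈ nearSet F c R₂, (z - u) ^ (nearMult F c R₂ u)) * G z) ∧
      ∀ z ∈ Metric.ball c R, z ≠ v → ∀ᶠ w in nhds z, h w = (∏ u ∈ (nearSet F c R₂).erase v, (w - u) ^ (nearMult F c R₂ u)) * G w := by
  classical
  obtain ⟨G, hG, hG0, hfac⟩ := Literature.Analysis.Complex.exists_eq_prod_pow_sub_mul hR₂ hR hF hc
  have hF₂ : AnalyticOnNhd ℂ F (Metric.closedBall c R₂) := hF.mono (Metric.closedBall_subset_closedBall hR)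
  have hfac' : ∀ z ∈ Metric.closedBall c R, F z = (∏ u ∈ nearSet F c R₂, (z - u) ^ (nearMult F c R₂ u)) * G z := fun z hz => by
    simpa only [nearSet, nearMult] using hfac z hz
  have hSin : ∀ u ∈ nearSet F c R₂, u ∈ Metric.closedBall c R₂ := fun u hu =>
    (MeromorphicOn.divisor F (Metric.closedBall c R₂)).supportWithinDomain ((Set.Finite.mem_toFinset _).1 hu)
  have hvS : v ∈ nearSet F c R₂ := mem_toFinset_of_simple hF₂ hv hord
  have hDv : nearMult F c R₂ v = 1 := by
    simp only [nearMult, divisor_eq_one_of_simple hF₂ hv hord]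
    rfl
  refine ⟨G, hG, hG0, hSin, ?_, hvS, hDv, hfac', ?_⟩
  · intro u hu
    have hDu : (MeromorphicOn.divisor F (Metric.closedBall c R₂)) u ≠ 0 := (Set.Finite.mem_toFinset _).1 hu
    have hnn : 0 ≤ (MeromorphicOn.divisor F (Metric.closedBall c R₂)) u := (MeromorphicOn.AnalyticOnNhd.divisor_nonneg hF₂) u
    have hpos : nearMult F c R₂ u ≠ 0 := by
      simp only [nearMult]; omega
    rw [hfac' u (Metric.closedBall_subset_closedBall hR (hSin u hu))]
    have : (u - u) ^ (nearMult F c R₂ u) = 0 := by rw [sub_self, zero_pow hpos]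
    rw [Finset.prod_eq_zero hu this, zero_mul]
  · intro z hz hzv
    have hU : Metric.ball c R ∈ nhds z := Metric.isOpen_ball.mem_nhds hz
    exact dslope_local_factor _ _ hU (fun w hw => hfac' w (Metric.ball_subset_closedBall hw)) hvS hDv hzv hFh

/-! ## The FAR-FIELD BOUND at the points where `F ≠ 0` (Landau's lemma at centre `c`, `Literature.Analysis.Complex.norm_logDeriv_sub_sum_le`, minus the near sum) -/

/-- FAR-FIELD BOUND (Titchmarsh §3.9 Lemma α at centre `c`, far factor isolated): with the disc factorisation `F = (∏_{u∈S}(· − u)^{D u})·G` of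
`cofactor_local_factor` (`S`, `D` = the divisor data of the inner ball `‖z − c‖ ≤ R₂`, `G` zero-free there), `|F| ≤ B` on the big ball and radii
`0 < r < r₁ < R₂ < R`: at every `z` with `‖z − c‖ ≤ r` and `F z ≠ 0`,
`‖G′/G(z)‖ ≤ (2r₁/((R₂ − r₁)(r₁ − r)))·(log(B/|F c|) + N·log(R/(R − R₂)) + 1)`, `N = Σ_S D`.  (The proviso `F z ≠ 0` is removed by continuity in a
sequel; the constant is the `ε` of `lipschitz_of_bounded_holo`.) -/
theorem farField_bound_of_ne_zero {F G : ℂ → ℂ} {c : ℂ} {r r₁ R₂ R B : ℝ} (hr : 0 < r) (hr₁ : r < r₁) (hR₂ : r₁ < R₂) (hR : R₂ < R)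
    (hF : AnalyticOnNhd ℂ F (Metric.closedBall c R)) (hc : F c ≠ 0) (hB : ∀ z ∈ Metric.closedBall c R, ‖F z‖ ≤ B)
    (hG : AnalyticOnNhd ℂ G (Metric.closedBall c R)) (hG0 : ∀ z ∈ Metric.closedBall c R₂, G z ≠ 0)
    (hfac : ∀ z ∈ Metric.closedBall c R, F z = (∏ u ∈ nearSet F c R₂, (z - u) ^ (nearMult F c R₂ u)) * G z)
    {z : ℂ} (hz : z ∈ Metric.closedBall c r) (hFz : F z ≠ 0) :
    ‖logDeriv G z‖ ≤ 2 * r₁ / ((R₂ - r₁) * (r₁ - r)) * (Real.log (B / ‖F c‖) +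
      (∑ u ∈ nearSet F c R₂, ((MeromorphicOn.divisor F (Metric.closedBall c R₂)) u : ℝ)) * Real.log (R / (R - R₂)) + 1) := by
  classical
  set Dv := MeromorphicOn.divisor F (Metric.closedBall c R₂) with hDv
  set S := nearSet F c R₂ with hS
  have hL := Literature.Analysis.Complex.norm_logDeriv_sub_sum_le hr hr₁ hR₂ hR hF hc hB hz hFz
  change ‖logDeriv F z - ∑ u ∈ S, ((Dv u : ℤ) : ℂ) / (z - u)‖ ≤ 2 * r₁ / ((R₂ - r₁) * (r₁ - r)) *
    (Real.log (B / ‖F c‖) + (∑ u ∈ S, (Dv u : ℝ)) * Real.log (R / (R - R₂)) + 1) at hL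
  have hR₂0 : 0 < R₂ := hr.trans (hr₁.trans hR₂)
  have hF₂ : AnalyticOnNhd ℂ F (Metric.closedBall c R₂) := hF.mono (Metric.closedBall_subset_closedBall hR.le)
  have hD0 : ∀ u, 0 ≤ Dv u := fun u => (MeromorphicOn.AnalyticOnNhd.divisor_nonneg hF₂) u
  -- z lies in the open big ball and in the inner ball
  have hzc : dist z c ≤ r := hz
  have hzR : z ∈ Metric.ball c R := by
    rw [Metric.mem_ball]; linarith
  have hzR₂ : z ∈ Metric.closedBall c R₂ := by
    rw [Metric.mem_closedBall]; linarith
  have hGz : G z ≠ 0 := hG0 z hzR₂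
  -- z is off the near set (else F z = 0)
  have hzS : ∀ a ∈ S, z ≠ a := by
    intro a ha hza
    apply hFz
    rw [hfac z (Metric.ball_subset_closedBall hzR)]
    have hDa : Dv a ≠ 0 := by
      have := (Set.Finite.mem_toFinset _).1 (show a ∈ ((MeromorphicOn.divisor F (Metric.closedBall c R₂)).finiteSupport
        (isCompact_closedBall c R₂)).toFinset from ha)
      exact this
    have hpos : 0 < nearMult F c R₂ a := by
      have h0 := hD0 a
      show 0 < (Dv a).toNat
      omega
    have : (z - a) ^ (nearMult F c R₂ a) = 0 := by
      rw [hza, sub_self, zero_pow hpos.ne']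
    rw [Finset.prod_eq_zero ha this, zero_mul]
  -- the split identity at z
  have heq : ∀ᶠ w in nhds z, F w = (∏ u ∈ S, (w - u) ^ (nearMult F c R₂ u)) * G w :=
    Filter.eventually_of_mem (Metric.isOpen_ball.mem_nhds hzR) fun w hw => hfac w (Metric.ball_subset_closedBall hw)
  have hsplit := field_split S (nearMult F c R₂) hzS (hG z (Metric.ball_subset_closedBall hzR)).differentiableAt hGz heq
  -- align the casts: (nearMult u : ℂ) = (Dv u : ℂ)
  have hcast : ∀ u, ((nearMult F c R₂ u : ℕ) : ℂ) = ((Dv u : ℤ) : ℂ) := by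
    intro u
    show (((Dv u).toNat : ℕ) : ℂ) = ((Dv u : ℤ) : ℂ)
    rw [← Int.cast_natCast, Int.toNat_of_nonneg (hD0 u)]
  have hsum : ∑ u ∈ S, ((nearMult F c R₂ u : ℕ) : ℂ) / (z - u) = ∑ u ∈ S, ((Dv u : ℤ) : ℂ) / (z - u) :=
    Finset.sum_congr rfl fun u _ => by rw [hcast u]
  have hGeq : logDeriv G z = logDeriv F z - ∑ u ∈ S, ((Dv u : ℤ) : ℂ) / (z - u) := by
    rw [logDeriv_apply, logDeriv_apply, hsplit, hsum]
    ring
  rw [hGeq]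
  exact hL


end RhW08.NewtonDoor
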